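import Literature.Computability.AlgebraicComplexity.GKSS19ShiftCalculus
import Literature.Computability.AlgebraicComplexity.IMMInVPProofs
import HarnessLib

/-!
# Guo–Kumar–Saptharishi–Solomon 2019, §3: Observation 21 in use — translating `P` to make the
# non-degeneracy polynomial `Ψ` visible at `z = 0`, and the bookkeeping of `Ψ`

Cell `val-lit`, seat t19 (literature-prover); groundwork for the discharge programme of
`GKSS2019_mainThm` (v2, erratum A34) along the printed proof of [GKSS19, §3]. THEOREM-ONLY (no
definitions, no named facts); nothing here bears on `VP ≠ VNP`, which is NOT proved.

Source: Z. Guo, M. Kumar, R. Saptharishi, N. Solomon, *Derandomization from algebraic hardness*,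
SIAM J. Comput. 51 (2022) = arXiv:1905.00091 [GuoKumarSaptharishiSolomon2019], §3, the paragraph
after Claim 23 (held text `paper:arxiv-1905.00091`, p0011.txt:L42–L50): "`C'` is a nonzero
polynomial of degree at most `D' ≤ D` such that `C' ∘ G_P = 0` and `∂_{x_n}(C') ∘ G_P ≠ 0`. By
Observation 21, we may assume without loss of generality that the constant term of
`∂_{x_n}(C') ∘ G_P(z, y)` — i.e., `∂_{x_n}(C') ∘ G_P(0, y)` — is a nonzero polynomial. Let `Ψ(y)`
denote `∂_{x_n}(C') ∘ G_P(0, y)`", with Obs. 21 (p0010.txt:L54–L56): "For any `a ∈ F^k`, if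
`P'(z) = P(z + a)`, then for all `i` we have `Δ_i(P')(z, y) = Δ_i(P)(z + a, y)`. Hence,
`G_{P'}(z, y) = G_P(z + a, y)`." The WLOG itself is p0011.txt:L51–L52: "Without loss of generality
(by translating `z` by a point in `{0,1,…,dD}^k` if necessary, via Observation 21), we may assume
that `(∂_{x_n}(C') ∘ G_P(0, y)) =: Ψ(y) ≠ 0`." CITATION NOTE (v2): the COST of undoing the
translation — `complexity P ≤ complexity (P(z + b)) + k` — is NOT a printed sentence of Obs. 21 (nor
of the held journal text anywhere); it is the routine accounting the WLOG needs (the printed proof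
absorbs it silently into the final `O(s·D·d³·n^{O(k)})` bound, p0012.txt:L25), proved here from
[Burgisser2000] Rem. 2.7 (tree `complexity_aeval_le`). v1 of this docstring misquoted it as part of
Obs. 21 under a wrong locator (val-lit ref-2 audit row 637); statements are unchanged.

## What is here (all in the `R[y]`-rendering of `AC/GKSS19ShiftCalculus.lean`, `R = F[z]`)

Write `W(P, Q) := Q(Δ_0(P), …, Δ_m(P)) = aeval (fun i => homogeneousComponent i (shiftR P)) Q ∈ R[y]`
(inline; `AC/GKSS19ShiftCalculus.bind₁_gen_eq_zero_iff` identifies it with `Q ∘ G_P^{≤ m}`).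
* `map_aeval_algHom`, `eval_C_aeval` — pushing an `F`-algebra map of `R`, resp. the evaluation
  `y := a`, through `Q(…)`;
* `aeval_gen_translate` — Obs. 21 for `W`: `W(P(z+b), Q) = τ_b W(P, Q)` coefficientwise
  (`τ_b : z ↦ z + b`);
* `eval_map_constantCoeff` — "`Ψ(a)`": evaluating the constant-term polynomial
  `Ψ := map constantCoeff W'` at `a` is the constant term of `W'(z, a)`, which is the `Ψ` of
  `AC/GKSS19Lemma24.lemma24` (`constantCoeff_aeval_eval`);
* `map_constantCoeff_translate` — `Ψ` of the translate `P(z+b)` is `W'(b, y)`: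
  `map constantCoeff (τ_b W') = map (eval b) W'`; `eval_map_eval_eq_eval_toZY_symm` — and its value
  at `a` is the value of `W' ∈ F[z ⊔ y]` at the point `(b, a)` (so a nonzero `W'` has good `(b, a)`);
* `complexity_le_complexity_translate_add`, `totalDegree_translate_le` — the cost `+ k` of undoing
  the translation (routine accounting behind the WLOG; not printed in Obs. 21), and degree
  bookkeeping.

## References
* [GuoKumarSaptharishiSolomon2019] arXiv:1905.00091, §3 (p0011.txt:L42–52: `C'`, `Ψ`, the WLOG),
  Obs. 21 (p0010.txt:L54–56), final accounting (p0012.txt:L25).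
* [Burgisser2000] Rem. 2.7 (tree `complexity_aeval_le`).
-/

noncomputable section

open MvPolynomial

namespace Literature.Computability.AlgebraicComplexity

namespace GKSS2019

universe u

variable {F : Type u} [Field F] {k : ℕ}

/-! ### Pushing maps through `Q(Δ_0, …, Δ_m)` -/

/-- An `F`-algebra endomorphism `f` of the coefficient ring `R` acts on `Q(g_0, …, g_m) ∈ R[y]`
(`Q` with coefficients in `F`) through the arguments. [cite: GuoKumarSaptharishiSolomon2019, Obs. 21 (arXiv p0010.txt:L54-56)] -/
theorem map_aeval_algHom {R : Type*} [CommRing R] [Algebra F R] {σ τ : Type*} (f : R →ₐ[F] R)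
    (g : τ → MvPolynomial σ R) (Q : MvPolynomial τ F) :
    map f.toRingHom (aeval g Q) = aeval (fun i => map f.toRingHom (g i)) Q := by
  induction Q using MvPolynomial.induction_on with
  | C c =>
    rw [MvPolynomial.algHom_C, MvPolynomial.algHom_C, MvPolynomial.algebraMap_apply, map_C]
    congr 1
    exact f.commutes c
  | add p q hp hq => rw [map_add, map_add, map_add, hp, hq]
  | mul_X p i hp => rw [map_mul, map_mul, map_mul, hp, aeval_X, aeval_X]

/-- The evaluation `y := a` (`a ∈ F^k`, constants of `R`) passes through `Q(g_0, …, g_m)`.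
[cite: GuoKumarSaptharishiSolomon2019, §3 (arXiv p0011.txt:L46-50), "`Ψ(a)`"] -/
theorem eval_C_aeval {R : Type*} [CommRing R] [Algebra F R] {σ τ : Type*} (a : σ → R)
    (g : τ → MvPolynomial σ R) (Q : MvPolynomial τ F) :
    eval a (aeval g Q) = aeval (fun i => eval a (g i)) Q := by
  induction Q using MvPolynomial.induction_on with
  | C c =>
    rw [MvPolynomial.algHom_C, MvPolynomial.algHom_C, MvPolynomial.algebraMap_apply, eval_C]
  | add p q hp hq => rw [map_add, map_add, map_add, hp, hq]
  | mul_X p i hp => rw [map_mul, map_mul, map_mul, hp, aeval_X, aeval_X]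

/-- `lemma24`'s `Ψ = constantCoeff (Q'(g))` with `g_i = Δ_i(z, a)` is the value at `a` of the
constant-term polynomial `map constantCoeff (Q'(Δ))`: first, evaluation at `a` of the
constant-term polynomial is the constant term of the evaluation `y := a`.
[cite: GuoKumarSaptharishiSolomon2019, §3 (arXiv p0011.txt:L46-50)] -/
theorem eval_map_constantCoeff {σ : Type*} (a : σ → F)
    (W : MvPolynomial σ (MvPolynomial (Fin k) F)) :
    eval a (map (constantCoeff : MvPolynomial (Fin k) F →+* F) W) =
      constantCoeff (eval (fun j => (C (a j) : MvPolynomial (Fin k) F)) W) := by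
  induction W using MvPolynomial.induction_on with
  | C r => rw [map_C, eval_C, eval_C]
  | add p q hp hq => rw [map_add, map_add, map_add, map_add, hp, hq]
  | mul_X p i hp =>
    rw [map_mul, map_mul, map_X, eval_X, map_mul, eval_X, map_mul, constantCoeff_C, hp]

/-- … hence `Ψ(a) = constantCoeff (Q'(Δ_0(z,a), …, Δ_m(z,a)))`.
[cite: GuoKumarSaptharishiSolomon2019, §3 (arXiv p0011.txt:L46-50)] -/
theorem constantCoeff_aeval_eval {σ τ : Type*} (a : σ → F)
    (g : τ → MvPolynomial σ (MvPolynomial (Fin k) F)) (Q : MvPolynomial τ F) :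
    constantCoeff (aeval (fun i => eval (fun j => (C (a j) : MvPolynomial (Fin k) F)) (g i)) Q) =
      eval a (map (constantCoeff : MvPolynomial (Fin k) F →+* F) (aeval g Q)) := by
  rw [eval_map_constantCoeff, eval_C_aeval]

/-! ### Observation 21: translating `z` -/

/-- **Obs. 21 for `Q(Δ_0(P), …, Δ_m(P))`**: replacing `P` by `P(z + b)` applies `τ_b : z ↦ z + b`
coefficientwise ("`Δ_i(P(z + a)) = (Δ_i(P))(z + a, y)`").
[cite: GuoKumarSaptharishiSolomon2019, Obs. 21 (arXiv p0010.txt:L54-56)] -/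
theorem aeval_gen_translate (b : Fin k → F) (P : MvPolynomial (Fin k) F) {m : ℕ}
    (Q : MvPolynomial (Fin (m + 1)) F) :
    aeval (fun i : Fin (m + 1) => homogeneousComponent (i : ℕ)
        (shiftR (aeval (fun j : Fin k => (X j + C (b j) : MvPolynomial (Fin k) F)) P))) Q =
      map ((aeval (fun j : Fin k => (X j + C (b j) : MvPolynomial (Fin k) F))).toRingHom)
        (aeval (fun i : Fin (m + 1) => homogeneousComponent (i : ℕ) (shiftR P)) Q) := by
  simp_rw [homogeneousComponent_shiftR_translate]
  exact (map_aeval_algHom (aeval (fun j : Fin k => (X j + C (b j) : MvPolynomial (Fin k) F)))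
    (fun i : Fin (m + 1) => homogeneousComponent (i : ℕ) (shiftR P)) Q).symm

/-- Constant term of a translate: `(τ_b r)(0) = r(b)`. [cite: GuoKumarSaptharishiSolomon2019, Obs. 21 (arXiv p0010.txt:L54-56)] -/
theorem constantCoeff_translate (b : Fin k → F) (r : MvPolynomial (Fin k) F) :
    constantCoeff (aeval (fun j : Fin k => (X j + C (b j) : MvPolynomial (Fin k) F)) r) =
      eval b r := by
  induction r using MvPolynomial.induction_on with
  | C c => rw [MvPolynomial.algHom_C, MvPolynomial.algebraMap_eq, constantCoeff_C, eval_C]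
  | add p q hp hq => rw [map_add, map_add, map_add, hp, hq]
  | mul_X p j hp =>
    rw [map_mul, map_mul, hp, aeval_X, map_add, constantCoeff_X, constantCoeff_C, zero_add,
      map_mul, eval_X]

/-- The constant-term polynomial of a translate: `(τ_b W)(0, y) = W(b, y)`, i.e.
`map constantCoeff (τ_b W) = map (eval b) W`. [cite: GuoKumarSaptharishiSolomon2019, Obs. 21 and §3 (arXiv p0010.txt:L54-56, p0011.txt:L44-52)] -/
theorem map_constantCoeff_translate {σ : Type*} (b : Fin k → F)
    (W : MvPolynomial σ (MvPolynomial (Fin k) F)) :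
    map (constantCoeff : MvPolynomial (Fin k) F →+* F)
        (map ((aeval (fun j : Fin k => (X j + C (b j) : MvPolynomial (Fin k) F))).toRingHom) W) =
      map (eval b) W := by
  have h : (constantCoeff : MvPolynomial (Fin k) F →+* F).comp
      ((aeval (fun j : Fin k => (X j + C (b j) : MvPolynomial (Fin k) F))).toRingHom) = eval b :=
    RingHom.ext fun r => constantCoeff_translate b r
  rw [map_map, h]

/-- `Ψ` of the translate `P(z+b)`: `Ψ_{P(z+b)} = W(b, y)` where `W = (∂_{x_m} Q)(Δ(P))`.
[cite: GuoKumarSaptharishiSolomon2019, §3 (arXiv p0011.txt:L44-47)] -/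
theorem psi_translate (b : Fin k → F) (P : MvPolynomial (Fin k) F) {m : ℕ}
    (Q' : MvPolynomial (Fin (m + 1)) F) :
    map (constantCoeff : MvPolynomial (Fin k) F →+* F)
        (aeval (fun i : Fin (m + 1) => homogeneousComponent (i : ℕ)
          (shiftR (aeval (fun j : Fin k => (X j + C (b j) : MvPolynomial (Fin k) F)) P))) Q') =
      map (eval b) (aeval (fun i : Fin (m + 1) => homogeneousComponent (i : ℕ) (shiftR P)) Q') := by
  rw [aeval_gen_translate, map_constantCoeff_translate]

/-- Joint evaluation: the value of `W(b, y)` at `y = a` is the value of `W ∈ F[z ⊔ y]`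
(`z = inl`, `y = inr`, via `toZY`) at the point `(b, a)`.
[cite: GuoKumarSaptharishiSolomon2019, §3 (arXiv p0011.txt:L77-82), "as long as `Ψ(a) ≠ 0`"] -/
theorem eval_map_eval_toZY (b a : Fin k → F) (V : MvPolynomial (Fin k ⊕ Fin k) F) :
    eval a (map (eval b) (toZY F k V)) = eval (Sum.elim b a) V := by
  induction V using MvPolynomial.induction_on with
  | C c => rw [toZY_C, map_C, eval_C, eval_C, eval_C]
  | add p q hp hq => rw [map_add, map_add, map_add, map_add, hp, hq]
  | mul_X p i hp =>
    rw [map_mul, map_mul, map_mul, map_mul, hp, eval_X]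
    rcases i with j | j
    · rw [toZY_X_inl, map_C, eval_C, eval_X, Sum.elim_inl]
    · rw [toZY_X_inr, map_X, eval_X, Sum.elim_inr]

/-- The same with `W ∈ R[y]` given: `(map (eval b) W)(a) = (toZY⁻¹ W)(b, a)`.
[cite: GuoKumarSaptharishiSolomon2019, §3 (arXiv p0011.txt:L77-82)] -/
theorem eval_map_eval_eq_eval_toZY_symm (b a : Fin k → F)
    (W : MvPolynomial (Fin k) (MvPolynomial (Fin k) F)) :
    eval a (map (eval b) W) = eval (Sum.elim b a) ((toZY F k).symm W) := by
  conv_lhs => rw [← (toZY F k).apply_symm_apply W]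
  exact eval_map_eval_toZY b a _

/-! ### Undoing the translation of Observation 21: cost and degree (routine accounting) -/

/-- Undoing the translation: `P = (P(z + b))(z - b)`. [cite: GuoKumarSaptharishiSolomon2019, §3 WLOG via Obs. 21 (arXiv p0011.txt:L51-52, p0010.txt:L54-56)] -/
theorem aeval_translate_neg_translate (b : Fin k → F) (P : MvPolynomial (Fin k) F) :
    aeval (fun j : Fin k => (X j + C (-b j) : MvPolynomial (Fin k) F))
        (aeval (fun j : Fin k => (X j + C (b j) : MvPolynomial (Fin k) F)) P) = P := by
  rw [← AlgHom.comp_apply, comp_aeval]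
  have : (fun j : Fin k => aeval (fun j : Fin k => (X j + C (-b j) : MvPolynomial (Fin k) F))
      (X j + C (b j) : MvPolynomial (Fin k) F)) = X := by
    funext j
    simp
  rw [this, aeval_X_left, AlgHom.id_apply]

/-- **Cost of undoing the translation** (the accounting behind the WLOG "by translating `z` by a
point … via Observation 21", p0011.txt:L51-52; NOT a printed sentence — the journal text absorbs it
into the final `O(s·D·d³·n^{O(k)})` bound, p0012.txt:L25): if `P(z + b)` has a circuit of size `s`
then `P(z)` has one of size at most `s + k` (tree measure `complexity`; [Burgisser2000] Rem. 2.7,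
tree `complexity_aeval_le`, with the `k` substitutions `z_j ↦ z_j − b_j` of cost `1` each).
[cite: GuoKumarSaptharishiSolomon2019, §3 WLOG via Obs. 21 (arXiv p0011.txt:L51-52, p0010.txt:L54-56; accounting p0012.txt:L25)] -/
theorem complexity_le_complexity_translate_add (b : Fin k → F) (P : MvPolynomial (Fin k) F) :
    complexity P ≤
      complexity (aeval (fun j : Fin k => (X j + C (b j) : MvPolynomial (Fin k) F)) P) + k := by
  conv_lhs => rw [← aeval_translate_neg_translate b P]
  refine (complexity_aeval_le _ _).trans (Nat.add_le_add_left ?_ _)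
  calc ∑ j : Fin k, complexity (X j + C (-b j) : MvPolynomial (Fin k) F)
      ≤ ∑ _j : Fin k, 1 := Finset.sum_le_sum fun j _ => by
        calc complexity (X j + C (-b j) : MvPolynomial (Fin k) F)
            ≤ complexity (X j : MvPolynomial (Fin k) F) +
                complexity (C (-b j) : MvPolynomial (Fin k) F) + 1 := complexity_add_le_holds _ _
          _ = 1 := by rw [complexity_X_holds, complexity_C_holds]
    _ = k := by simp

/-- Degree bookkeeping: a translate has total degree at most that of `P`.
[cite: GuoKumarSaptharishiSolomon2019, Obs. 21 (arXiv p0010.txt:L54-56)] -/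
theorem totalDegree_translate_le (b : Fin k → F) (P : MvPolynomial (Fin k) F) :
    (aeval (fun j : Fin k => (X j + C (b j) : MvPolynomial (Fin k) F)) P).totalDegree ≤
      P.totalDegree := by
  classical
  have hφ : ∀ j : Fin k, (X j + C (b j) : MvPolynomial (Fin k) F).totalDegree ≤ 1 := fun j =>
    (totalDegree_add _ _).trans (max_le (by rw [totalDegree_X]) (by rw [totalDegree_C]; omega))
  conv_lhs => rw [P.as_sum]
  rw [map_sum]
  refine totalDegree_finsetSum_le fun e he => ?_
  rw [aeval_monomial]
  refine (totalDegree_mul _ _).trans ?_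
  rw [← C_eq_algebraMap, totalDegree_C, zero_add, Finsupp.prod_fintype _ _ (fun _ => pow_zero _)]
  refine (totalDegree_finsetProd _ _).trans ?_
  calc ∑ j, ((X j + C (b j) : MvPolynomial (Fin k) F) ^ e j).totalDegree
      ≤ ∑ j, e j := Finset.sum_le_sum fun j _ =>
        (totalDegree_pow _ _).trans ((Nat.mul_le_mul_left _ (hφ j)).trans (by simp))
    _ ≤ P.totalDegree := by
        have h := le_totalDegree he
        rwa [Finsupp.sum_fintype _ _ (fun _ => rfl)] at h

end GKSS2019

end Literature.Computability.AlgebraicComplexity
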